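import Literature.NumberTheory.EllipticCurves.EisensteinNewformLevelRaisingDeligneSerreLiftProofs
import Literature.NumberTheory.EllipticCurves.PrimeLevelEigenpacketNewformProofs
import Literature.NumberTheory.EllipticCurves.HeckeEigenvectorModPOfCongruence
import Literature.NumberTheory.EllipticCurves.EisensteinSeriesNebentypusLevelRaisedLargeWeight
import Literature.NumberTheory.EllipticCurves.HeckeOperatorsDoubleCoset
import Literature.NumberTheory.EllipticCurves.HeckeOperatorsDiamondCommProofs
import Literature.NumberTheory.EllipticCurves.NewformGaloisRepIntegralityProofs
import Literature.NumberTheory.ModularForms.TwistedDivisorSumsHecke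
import HarnessLib

/-!
# From a cusp form congruent to `E_k^{𝟙,χ} - E_k^{𝟙,χ}(M·)` to a newform congruent to
# `1 ⊕ χ χ_p^{k-1}` (Billerey–Menares 2016, proof of Thm. 2.2: the steps after "`F` is cuspidal")

Topic `Literature/NumberTheory/EllipticCurves`; namespace
`Literature.NumberTheory.EllipticCurves.ModularForms`.  THEOREMS ONLY (no definition, no named
fact; D-0026).  A proofs-only companion of the named facts
`Literature.NumberTheory.EllipticCurves.BillereyMenares2016_thm22_exists_newform(_odd)`
(`EisensteinNewformLevelRaising.lean`).

N. Billerey, R. Menares, *On the modularity of reducible mod `l` Galois representations*, Math.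
Res. Lett. 23 (2016), §2, proof of Thm. 2.2 (p. 7), after the computation of the constant terms:
"Therefore … the reduction `F` of `E` modulo `λ` is a cuspidal eigenform with coefficients in
`𝔽̄_l` and eigenvalues `1 + ε(q)q^{k-1}` for every prime `q ∤ Np`.  According to [DeSe74] we can
find a form `f ∈ S_k(Γ₀(Np), ε₀)` which is an eigenform for the Hecke operators `{T_q}_{q ∤ Np}`
with corresponding eigenvalues `{a_q}` satisfying `a_q ≡ 1 + ε(q)q^{k-1} (mod 𝓛)`.  Hence the
representation `1 ⊕ εχ_l^{k-1}` arises from an eigenform in `S_k(Γ₀(Np), ε₀)` as claimed."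
(Their level-raising prime `p` is our `M`, their `l` our `p`, their `ε₀` our `χ`.)

## The statement (`exists_isNewform1_of_cuspidal_congruence`)

Let `χ` be a primitive Dirichlet character modulo `N` with `χ(-1) = (-1)^k`, `k ≥ 3`, of order
prime to `p`, `M ∤ N` a prime `≠ p`, `ι : ℚ̄_p ≃ ℂ`, and let
`E = eisensteinLevelRaised N k χ M = E_k^{𝟙,χ} - E_k^{𝟙,χ}(M·) ∈ M_k(Γ₁(NM))`
(`EisensteinSeriesNebentypusLevelRaised`).  **IF** there is a cusp form `f₀ ∈ S_k(NM, χ)` (exact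
nebentypus `χ` read modulo `NM`) with `aₙ(f₀) ≡ aₙ(E) (mod 𝔪)` for all `n` — the "cuspidal
reduction" of the quotation — **THEN** there are `N' ∈ {N, NM}` and a newform `g ∈ S_k(Γ₁(N'))`
of nebentypus `χ (mod N')` with

  `ι⁻¹ a_ℓ(g) ≡ ι⁻¹ (1 + χ(ℓ) ℓ^{k-1}) (mod 𝔪)` for EVERY prime `ℓ ∤ N'`

— including `ℓ = p` and, when `N' = N`, the level-raising prime `ℓ = M`.

## The proof (assembled from the tree)

* `f₀` is a `T_q`-eigenvector modulo `𝔪` for every prime `q ∤ NM`, eigenvalue `1 + χ(q)q^{k-1}`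
  (`valuation_cuspCoeff_heckeT_sub_lt_one` with the formal Hecke relations of the level-raised
  twisted divisor sums, `Literature.NumberTheory.ModularForms.levelRaised_hecke`), and a
  `U_M`-eigenvector modulo `𝔪` with eigenvalue `χ(M) M^{k-1}` (`a_n(U_M f₀) = a_{Mn}(f₀)` and
  `a_{Mn}(E) = χ(M)M^{k-1} aₙ(E)`, from `twistedSigma_hecke` at `q = M`); its coefficients are
  `p`-integral (`valuation_qExpansion_coeff_eisensteinLevelRaised_le_one_of_le`) and `a₁(f₀) ≡ 1`
  is a unit.
* The Deligne–Serre lifting engine `DeligneSerreLift.exists_eigenform_of_congruence`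
  (`EisensteinNewformLevelRaisingDeligneSerreLiftProofs`; here in the indexed form
  `DeligneSerreLift.exists_eigenform_of_congruence_family`) applied to the commuting family
  `{T_q}_{q ∤ N prime}` (which contains `U_M`; `heckeT_comm_holds`, `heckeT_diamondOp_comm_holds`,
  `heckeT_mem_integralLattice1`) yields a genuine eigenform `g₁ ∈ S_k(NM, χ)` with eigenvalues
  `≡` the targets.
* `exists_isNewform1_of_eigenpacket_prime_level` (`PrimeLevelEigenpacketNewformProofs`): the
  packet of `g₁` is that of a newform `g` of level `N' ∈ {N, NM}` whose nebentypus induces `χ`,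
  with `a_q(g) = a_q(g₁)` for `q ∤ NM` and, if `N' = N`, `μ² - a_M(g)μ + χ(M)M^{k-1} = 0` for the
  `U_M`-eigenvalue `μ ≡ χ(M)M^{k-1}` of `g₁`; as `χ(M)M^{k-1}` is a unit (`M ≠ p`),
  `a_M(g) = μ + χ(M)M^{k-1}/μ ≡ χ(M)M^{k-1} + 1`.

## References

* N. Billerey, R. Menares, *On the modularity of reducible mod `l` Galois representations*, Math.
  Res. Lett. 23 (2016), 15–41, §2, proof of Thm. 2.2 (p. 7). [BillereyMenares2016]
* P. Deligne, J.-P. Serre, *Formes modulaires de poids 1*, Ann. Sci. ÉNS (4) 7 (1974), 507–530,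
  Lemme 6.11. [DeligneSerreASENS1974]
* F. Diamond, J. Shurman, *A first course in modular forms*, GTM 228 (2005), Prop. 5.2.2 (5.3),
  Prop. 5.6.2, Thm. 5.8.2–5.8.3. [DiamondShurman2005]
-/

noncomputable section

open scoped MatrixGroups ModularForm
open CongruenceSubgroup UpperHalfPlane

namespace Literature.NumberTheory.EllipticCurves.ModularForms

/-! ### The lifting engine for an indexed family of operators -/

namespace DeligneSerreLift

variable {p : ℕ} [Fact p.Prime] {N : ℕ} [NeZero N] {k : ℤ}

/-- **Deligne–Serre lifting, indexed form.**  `exists_eigenform_of_congruence` for a family of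
operators `T : Q → End S_k(Γ₁(N))` indexed by any type, with targets `t : Q → ℚ̄_p`: if the `T q`
commute pairwise and with the diamond operators, preserve the lattice `L`, and
`ι⁻¹ aₙ(T q f₀) ≡ t q · ι⁻¹ aₙ(f₀) (mod 𝔪)` for a form `f₀ ∈ S_k(N, χ₀)` (`χ₀^m = 1`, `p ∤ m`) with
`p`-integral coefficients one of which is a unit, then some non-zero `g ∈ S_k(N, χ₀)` satisfies
`T q g = ι(a'_q) g` with `‖a'_q‖ ≤ 1`, `‖a'_q - t q‖ < 1` for all `q`.
[cite: DeligneSerreASENS1974, 6.10 and Lemme 6.11] [cite: BillereyMenares2016, §2, proof of Thm. 2.2 (p. 7)] -/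
theorem exists_eigenform_of_congruence_family (ι : PadicAlgCl p ≃+* ℂ) (hk : 1 ≤ k)
    {χ₀ : DirichletCharacter ℂ N} {m : ℕ} (hm : ¬ p ∣ m) (hχm : χ₀ ^ m = 1)
    {Q : Type*} (T : Q → Module.End ℂ (CuspForm (Gamma1 N) k))
    (hcomm : ∀ q r, Commute (T q) (T r))
    (hdiam : ∀ q (d : (ZMod N)ˣ), Commute (T q) (diamondOp N k (d : ZMod N)))
    (hΛ : ∀ q, ∀ x ∈ integralLattice1 N k, T q x ∈ integralLattice1 N k)
    (t : Q → PadicAlgCl p) (ht : ∀ q, ‖t q‖ ≤ 1)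
    {f₀ : CuspForm (Gamma1 N) k} (hf₀ : f₀ ∈ nebentypusSubspace N k χ₀)
    (hint : ∀ n, ‖ι.symm (cuspCoeff f₀ n)‖ ≤ 1) {n₀ : ℕ} (hunit : ‖ι.symm (cuspCoeff f₀ n₀)‖ = 1)
    (hcongr : ∀ q n, ‖ι.symm (cuspCoeff (T q f₀) n) - t q * ι.symm (cuspCoeff f₀ n)‖ < 1) :
    ∃ (g : CuspForm (Gamma1 N) k) (a' : Q → PadicAlgCl p),
      g ≠ 0 ∧ g ∈ nebentypusSubspace N k χ₀ ∧
      ∀ q, ‖a' q‖ ≤ 1 ∧ ‖a' q - t q‖ < 1 ∧ T q g = ι (a' q) • g := by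
  classical
  have hsub : ∀ x y : PadicAlgCl p, ‖x - y‖ ≤ max ‖x‖ ‖y‖ := fun x y ↦ by
    simpa only [sub_eq_add_neg, norm_neg] using IsUltrametricDist.norm_add_le_max x (-y)
  -- targets as a function of the operator
  let a : Module.End ℂ (CuspForm (Gamma1 N) k) → PadicAlgCl p := fun S ↦
    if h : ∃ q, T q = S then t h.choose else 0
  have ha : ∀ q, ∃ r, T r = T q ∧ a (T q) = t r := fun q ↦ by
    have h : ∃ r, T r = T q := ⟨q, rfl⟩
    exact ⟨h.choose, h.choose_spec, dif_pos h⟩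
  obtain ⟨g, a', hg0, hgχ, hall⟩ := exists_eigenform_of_congruence ι hk hm hχm (Set.range T)
    (by rintro _ ⟨q, rfl⟩ _ ⟨r, rfl⟩; exact hcomm q r)
    (by rintro _ ⟨q, rfl⟩ d; exact hdiam q d)
    (by rintro _ ⟨q, rfl⟩ x hx; exact hΛ q x hx)
    a (by rintro _ ⟨q, rfl⟩; obtain ⟨r, -, hr⟩ := ha q; rw [hr]; exact ht r)
    hf₀ hint hunit
    (by rintro _ ⟨q, rfl⟩ n; obtain ⟨r, hrq, hr⟩ := ha q; rw [hr, ← hrq]; exact hcongr r n)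
  refine ⟨g, fun q ↦ a' (T q), hg0, hgχ, fun q ↦ ?_⟩
  obtain ⟨h1, h2, h3⟩ := hall (T q) ⟨q, rfl⟩
  refine ⟨h1, ?_, h3⟩
  obtain ⟨r, hrq, hr⟩ := ha q
  rw [hr] at h2
  -- `t r ≡ t q`: both are eigenvalues of `T q = T r` on `f₀` modulo `𝔪`, at the unit coefficient
  have h4 : ‖t r - t q‖ < 1 := by
    have e1 := hcongr r n₀
    have e2 := hcongr q n₀
    rw [hrq] at e1
    have h5 : (t r - t q) * ι.symm (cuspCoeff f₀ n₀) =
        (ι.symm (cuspCoeff (T q f₀) n₀) - t q * ι.symm (cuspCoeff f₀ n₀)) -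
          (ι.symm (cuspCoeff (T q f₀) n₀) - t r * ι.symm (cuspCoeff f₀ n₀)) := by ring
    have h6 : ‖(t r - t q) * ι.symm (cuspCoeff f₀ n₀)‖ < 1 := by
      rw [h5]; exact (hsub _ _).trans_lt (max_lt e2 e1)
    rwa [norm_mul, hunit, mul_one] at h6
  have h7 : a' (T q) - t q = (a' (T q) - t r) + (t r - t q) := by ring
  rw [h7]
  exact (IsUltrametricDist.norm_add_le_max _ _).trans_lt (max_lt h2 h4)

end DeligneSerreLift

/-! ### From the cuspidal congruence to the newform -/

section Main

variable {p : ℕ} [Fact p.Prime] {N M : ℕ} [NeZero N] [NeZero M] {k : ℕ}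

set_option maxHeartbeats 800000 in
/-- **Billerey–Menares 2016, proof of Thm. 2.2, from "`F` is a cuspidal eigenform" to the
newform.**  Let `χ` be a primitive Dirichlet character modulo `N`, `χ(-1) = (-1)^k`, `k ≥ 3`,
`χ^m = 1` with `p ∤ m`; `M ∤ N` a prime, `M ≠ p`; `ι : ℚ̄_p ≃ ℂ`;
`E = eisensteinLevelRaised N k χ M = E_k^{𝟙,χ} - E_k^{𝟙,χ}(M·)`.  If a cusp form
`f₀ ∈ S_k(NM, χ)` satisfies `ι⁻¹(aₙ(f₀) - aₙ(E)) ∈ 𝔪` for all `n`, then there are `N' ∈ {N, NM}`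
and a newform `g ∈ S_k(Γ₁(N'))` of nebentypus `χ (mod N')` with
`ι⁻¹ a_ℓ(g) ≡ ι⁻¹(1 + χ(ℓ)ℓ^{k-1}) (mod 𝔪)` for every prime `ℓ ∤ N'`.
[cite: BillereyMenares2016, §2, proof of Thm. 2.2 (p. 7)] [cite: DeligneSerreASENS1974, Lemme 6.11]
[cite: DiamondShurman2005, Prop. 5.6.2, Thm. 5.8.2] -/
theorem exists_isNewform1_of_cuspidal_congruence (ι : PadicAlgCl p ≃+* ℂ)
    {χ : DirichletCharacter ℂ N} (hχ : χ.IsPrimitive) (hk : 3 ≤ k) (hpar : χ (-1) = (-1) ^ k)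
    {m : ℕ} (hm : ¬ p ∣ m) (hχm : χ ^ m = 1) (hM : M.Prime) (hMN : ¬ M ∣ N) (hMp : M ≠ p)
    {f₀ : CuspForm (Gamma1 (N * M)) k}
    (hf₀ : f₀ ∈ nebentypusSubspace (N * M) k (DirichletCharacter.changeLevel (dvd_mul_right N M) χ))
    (hcongr : ∀ n, Valued.v (ι.symm (cuspCoeff f₀ n -
      (qExpansion 1 ⇑(eisensteinLevelRaised N k χ M hk)).coeff n)) < 1) :
    ∃ (N' : ℕ) (_ : NeZero N') (hN : N ∣ N') (g : CuspForm (Gamma1 N') k),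
      IsNewform1 g ∧ (N' = N ∨ N' = N * M) ∧
      nebentypus g = DirichletCharacter.changeLevel hN χ ∧
      ∀ ℓ : ℕ, ℓ.Prime → ¬ ℓ ∣ N' →
        Valued.v (ι.symm (cuspCoeff g ℓ) - ι.symm (1 + χ ℓ * (ℓ : ℂ) ^ ((k : ℤ) - 1))) < 1 := by
  classical
  have hp : p.Prime := Fact.out
  have hk1 : 1 ≤ (k : ℤ) := by omega
  have hNM : N ∣ N * M := dvd_mul_right N M
  set χL := DirichletCharacter.changeLevel hNM χ with hχL
  -- ### norms versus valuations in `ℚ̄_p`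
  have hvlt : ∀ x : PadicAlgCl p, Valued.v x < 1 ↔ ‖x‖ < 1 := fun x ↦ by
    rw [PadicAlgCl.valuation_def, ← NNReal.coe_lt_coe, coe_nnnorm, NNReal.coe_one]
  have hvle : ∀ x : PadicAlgCl p, Valued.v x ≤ 1 ↔ ‖x‖ ≤ 1 :=
    Literature.NumberTheory.GaloisRepresentations.PadicAlgCl.valuation_le_one_iff
  have hsub : ∀ x y : PadicAlgCl p, ‖x - y‖ ≤ max ‖x‖ ‖y‖ := fun x y ↦ by
    simpa only [sub_eq_add_neg, norm_neg] using IsUltrametricDist.norm_add_le_max x (-y)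
  have hχv : ∀ j : ZMod N, ‖ι.symm (χ j)‖ ≤ 1 := fun j ↦
    (hvle _).mp (valuation_ringEquiv_symm_apply_le_one χ ι j)
  have hnatv : ∀ n : ℕ, ‖ι.symm (n : ℂ)‖ ≤ 1 := fun n ↦ by
    rw [map_natCast]
    exact_mod_cast DeligneSerreLift.norm_intCast_le_one (p := p) (n : ℤ)
  have hMv : ‖ι.symm (M : ℂ)‖ = 1 := by
    rw [map_natCast]
    exact Literature.NumberTheory.GaloisRepresentations.PadicAlgCl.norm_natCast_of_not_dvd
      fun h ↦ hMp ((Nat.prime_dvd_prime_iff_eq hp hM).mp h).symm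
  -- ### the coefficients `b n` of `E` and their formal Hecke relations
  set E := eisensteinLevelRaised N k χ M hk with hE
  set b : ℕ → ℂ := fun n ↦ (qExpansion 1 ⇑E).coeff n with hb
  set σ : ℕ → ℂ := fun n ↦ ∑ d ∈ n.divisors, χ d * (d : ℂ) ^ (k - 1) with hσ
  have hbσ : ∀ n, b n = if n = 0 then 0 else σ n - (if M ∣ n then σ (n / M) else 0) :=
    fun n ↦ qExpansion_coeff_eisensteinLevelRaised k χ M hk hχ hpar n
  have hbint : ∀ n, ‖ι.symm (b n)‖ ≤ 1 := fun n ↦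
    (hvle _).mp (valuation_qExpansion_coeff_eisensteinLevelRaised_le_one_of_le k χ M ι hk hχ hpar n)
  have hb0 : b 0 = 0 := by rw [hbσ, if_pos rfl]
  have hb1 : b 1 = 1 := by
    have hM1 : ¬ M ∣ 1 := fun h ↦ hM.one_lt.ne' (Nat.dvd_one.mp h)
    rw [hbσ, if_neg one_ne_zero, if_neg hM1, sub_zero, hσ]
    simp
  -- ### `f₀`: integrality, the unit coefficient `a₁(f₀) ≡ 1`
  have hcongr' : ∀ n, ‖ι.symm (cuspCoeff f₀ n) - ι.symm (b n)‖ < 1 := fun n ↦ by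
    rw [← map_sub]; exact (hvlt _).mp (hcongr n)
  have hint : ∀ n, ‖ι.symm (cuspCoeff f₀ n)‖ ≤ 1 := fun n ↦ by
    have h1 : ι.symm (cuspCoeff f₀ n) = (ι.symm (cuspCoeff f₀ n) - ι.symm (b n)) + ι.symm (b n) := by
      ring
    rw [h1]
    exact (IsUltrametricDist.norm_add_le_max _ _).trans (max_le (hcongr' n).le (hbint n))
  have hunit : ‖ι.symm (cuspCoeff f₀ 1)‖ = 1 := by
    have h1 := hcongr' 1
    rw [hb1, map_one] at h1
    refine le_antisymm (hint 1) (not_lt.mp fun hlt ↦ ?_)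
    have h2 : ‖(1 : PadicAlgCl p)‖ < 1 := by
      have h3 : (1 : PadicAlgCl p) = ι.symm (cuspCoeff f₀ 1) - (ι.symm (cuspCoeff f₀ 1) - 1) := by
        ring
      rw [h3]
      exact (hsub _ _).trans_lt (max_lt hlt h1)
    rw [norm_one] at h2
    exact lt_irrefl _ h2
  -- ### the commuting family `{T_q}_{q ∤ N prime}` (it contains `U_M`) and its targets
  let Q := {q : ℕ // q.Prime ∧ ¬ q ∣ N}
  let T : Q → Module.End ℂ (CuspForm (Gamma1 (N * M)) k) := fun q ↦
    haveI : NeZero (q : ℕ) := ⟨q.2.1.ne_zero⟩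
    heckeT (Gamma1 (N * M)) k q
  have hT : ∀ q : Q, T q = (haveI : NeZero (q : ℕ) := ⟨q.2.1.ne_zero⟩;
      heckeT (Gamma1 (N * M)) k q) := fun q ↦ rfl
  -- the target eigenvalues: `χ(M) M^{k-1}` for `U_M`, `1 + χ(q) q^{k-1}` otherwise
  let lam : Q → ℂ := fun q ↦
    if (q : ℕ) = M then χ M * (M : ℂ) ^ (k - 1) else 1 + χ q * (q : ℂ) ^ (k - 1)
  have hlamv : ∀ q, ‖ι.symm (lam q)‖ ≤ 1 := by
    intro q
    simp only [lam]
    split_ifs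
    · rw [map_mul, map_pow, norm_mul, norm_pow]
      exact mul_le_one₀ (hχv _) (pow_nonneg (norm_nonneg _) _) (pow_le_one₀ (norm_nonneg _) (hnatv M))
    · rw [map_add, map_one, map_mul, map_pow]
      refine (IsUltrametricDist.norm_add_le_max _ _).trans (max_le (by rw [norm_one]) ?_)
      rw [norm_mul, norm_pow]
      exact mul_le_one₀ (hχv _) (pow_nonneg (norm_nonneg _) _) (pow_le_one₀ (norm_nonneg _) (hnatv q))
  -- ### `f₀` is an eigenvector modulo `𝔪` of every `T q`
  have hzpow : ∀ x : ℂ, x ^ ((k : ℤ) - 1) = x ^ (k - 1) := fun x ↦ by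
    rw [show ((k : ℤ) - 1) = ((k - 1 : ℕ) : ℤ) by omega, zpow_natCast]
  have hχLq : ∀ q : ℕ, q.Prime → ¬ q ∣ N * M → χL q = χ q := by
    intro q hq hqNM
    have hcop : IsCoprime (q : ℤ) ((N * M : ℕ) : ℤ) :=
      Nat.isCoprime_iff_coprime.mpr ((Nat.Prime.coprime_iff_not_dvd hq).2 hqNM)
    have h := DirichletCharacter.changeLevel_eq_cast_of_dvd' χ hNM hcop
    rw [Int.cast_natCast, Int.cast_natCast] at h
    rw [hχL]
    exact h
  -- `b (M n) = χ(M) M^{k-1} b n`: `U_M E = χ(M)M^{k-1} E`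
  have hbM : ∀ n, b (M * n) = χ M * (M : ℂ) ^ (k - 1) * b n := by
    intro n
    rcases Nat.eq_zero_or_pos n with rfl | hn
    · rw [mul_zero, hb0, mul_zero]
    · have h := Literature.NumberTheory.ModularForms.twistedSigma_hecke χ (k - 1) hM hn.ne'
      rw [hbσ, hbσ n, if_neg (Nat.mul_ne_zero hM.ne_zero hn.ne'), if_neg hn.ne',
        if_pos (dvd_mul_right M n), Nat.mul_div_cancel_left n hM.pos]
      simp only [hσ]
      split_ifs at h ⊢ with hMn
      · linear_combination h
      · linear_combination h
  have hcongrT : ∀ (q : Q) (n : ℕ),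
      ‖ι.symm (cuspCoeff (T q f₀) n) - ι.symm (lam q) * ι.symm (cuspCoeff f₀ n)‖ < 1 := by
    rintro ⟨q, hq, hqN⟩ n
    haveI : NeZero q := ⟨hq.ne_zero⟩
    rw [← map_mul, ← map_sub, ← hvlt, hT]
    simp only [lam]
    by_cases hqM : q = M
    · -- `U_M`: `aₙ(U_M f₀) = a_{Mn}(f₀) ≡ b (M n) = χ(M)M^{k-1} b n ≡ χ(M)M^{k-1} aₙ(f₀)`
      rw [if_pos hqM, cuspCoeff_heckeT_gamma1 f₀ q hq n,
        if_pos (show q ∣ N * M from hqM ▸ dvd_mul_left M N), add_zero, hqM]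
      have hsplit : cuspCoeff f₀ (M * n) - χ M * (M : ℂ) ^ (k - 1) * cuspCoeff f₀ n =
          (cuspCoeff f₀ (M * n) - b (M * n)) -
            χ M * (M : ℂ) ^ (k - 1) * (cuspCoeff f₀ n - b n) := by
        rw [hbM]; ring
      rw [hsplit, map_sub, hvlt]
      refine (hsub _ _).trans_lt (max_lt ?_ ?_)
      · rw [map_sub]; exact hcongr' _
      · rw [map_mul, norm_mul, map_sub]
        have hlM := hlamv ⟨M, hM, hMN⟩
        simp only [lam, if_pos rfl] at hlM
        calc ‖ι.symm (χ M * (M : ℂ) ^ (k - 1))‖ * ‖ι.symm (cuspCoeff f₀ n) - ι.symm (b n)‖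
            ≤ 1 * ‖ι.symm (cuspCoeff f₀ n) - ι.symm (b n)‖ := by gcongr
          _ < 1 := by rw [one_mul]; exact hcongr' n
    · -- `T_q`, `q ∤ NM`
      have hqM' : ¬ q ∣ M := fun h ↦ hqM ((Nat.prime_dvd_prime_iff_eq hq hM).mp h)
      have hqNM : ¬ q ∣ N * M := fun h ↦ by
        rcases (Nat.Prime.dvd_mul hq).1 h with h1 | h1
        · exact hqN h1
        · exact hqM' h1
      rw [if_neg hqM]
      refine valuation_cuspCoeff_heckeT_sub_lt_one ι hf₀ hq hqNM b
        (1 + χ q * (q : ℂ) ^ (k - 1)) ?_ ?_ ?_ ?_ n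
      · -- the formal Hecke relation of the level-raised twisted divisor sums
        intro n hn
        have hqn : q * n ≠ 0 := Nat.mul_ne_zero hq.ne_zero hn
        have h := Literature.NumberTheory.ModularForms.levelRaised_hecke χ (k - 1) hq hqM'
          hM.ne_zero hn
        rw [hχLq q hq hqNM, hzpow, hbσ (q * n), hbσ n, if_neg hqn, if_neg hn]
        have hdiv : (if q ∣ n then b (n / q) else 0) =
            (if q ∣ n then (σ (n / q) - if M ∣ n / q then σ (n / q / M) else 0) else 0) := by
          by_cases hqd : q ∣ n
          · have hnq : n / q ≠ 0 := by
              obtain ⟨c, rfl⟩ := hqd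
              rw [Nat.mul_div_cancel_left c hq.pos]
              rintro rfl
              exact hn (mul_zero q)
            rw [if_pos hqd, if_pos hqd, hbσ, if_neg hnq]
          · rw [if_neg hqd, if_neg hqd]
        rw [hdiv]
        simp only [hσ] at h ⊢
        exact h
      · rw [hχLq q hq hqNM, hzpow, hvle, map_mul, map_pow, norm_mul, norm_pow]
        exact mul_le_one₀ (hχv _) (pow_nonneg (norm_nonneg _) _) (pow_le_one₀ (norm_nonneg _) (hnatv q))
      · have hl := hlamv ⟨q, hq, hqN⟩
        simp only [lam, if_neg hqM] at hl
        exact (hvle _).mpr hl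
      · exact fun n _ ↦ hcongr n
  -- ### Deligne–Serre: a genuine eigenform `g ∈ S_k(NM, χ)` with eigenvalues `≡` the targets
  have hχLm : χL ^ m = 1 := by rw [hχL, ← map_pow, hχm, map_one]
  obtain ⟨g, a', hg0, hgχ, hall⟩ := DeligneSerreLift.exists_eigenform_of_congruence_family ι hk1
    hm hχLm T
    (fun q r ↦ by
      haveI : NeZero (q : ℕ) := ⟨q.2.1.ne_zero⟩
      haveI : NeZero (r : ℕ) := ⟨r.2.1.ne_zero⟩
      exact heckeT_comm_holds (N * M) k q r)
    (fun q d ↦ by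
      haveI : NeZero (q : ℕ) := ⟨q.2.1.ne_zero⟩
      exact heckeT_diamondOp_comm_holds (N * M) k q d)
    (fun q x hx ↦ by
      haveI : NeZero (q : ℕ) := ⟨q.2.1.ne_zero⟩
      exact heckeT_mem_integralLattice1 hk1 hx q q.2.1)
    (fun q ↦ ι.symm (lam q)) hlamv hf₀ hint hunit hcongrT
  -- ### the newform behind the packet of `g`
  let aC : ℕ → ℂ := fun q ↦ if h : q.Prime ∧ ¬ q ∣ N then ι (a' ⟨q, h⟩) else 0
  have hTg : ∀ (q : ℕ) (hq : q.Prime), ¬ q ∣ N * M →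
      (haveI : NeZero q := ⟨hq.ne_zero⟩; heckeT (Gamma1 (N * M)) k q g) = aC q • g := by
    intro q hq hqNM
    have hqN : ¬ q ∣ N := fun h ↦ hqNM (h.mul_right M)
    have h1 := (hall ⟨q, hq, hqN⟩).2.2
    simp only [aC, dif_pos (And.intro hq hqN)]
    exact h1
  have hUg : heckeT (Gamma1 (N * M)) k M g = ι (a' ⟨M, hM, hMN⟩) • g :=
    (hall ⟨M, hM, hMN⟩).2.2
  obtain ⟨N', _, hN', g₀, hnew, hlevel, hcoef, hquad, hneb⟩ :=
    exists_isNewform1_of_eigenpacket_prime_level hM hMN hχ hg0 hgχ hTg hUg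
  have hNN' : N ∣ N' := by
    rcases hlevel with h | h
    · rw [h]
    · rw [h]; exact hNM
  refine ⟨N', ‹NeZero N'›, hNN', g₀, hnew, hlevel, ?_, ?_⟩
  · -- ### the nebentypus of `g₀` is `χ (mod N')`
    rcases hlevel with h | h
    · subst h
      have h2 : nebentypus g₀ = χ := DirichletCharacter.changeLevel_injective hN' hneb
      rw [h2, DirichletCharacter.changeLevel_self]
    · subst h
      rw [DirichletCharacter.changeLevel_self] at hneb
      exact hneb
  · -- ### the congruences at the primes `ℓ ∤ N'`
    intro ℓ hℓ hℓN'
    have hℓN : ¬ ℓ ∣ N := fun h ↦ hℓN' (h.trans hNN')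
    by_cases hℓM : ℓ = M
    · -- `ℓ = M`: then `N' = N`, and `a_M(g₀) = μ + χ(M)M^{k-1}/μ` with `μ ≡ χ(M)M^{k-1}` a unit
      have hN'N : N' = N := by
        rcases hlevel with h | h
        · exact h
        · exfalso
          apply hℓN'
          rw [h, hℓM]
          exact dvd_mul_left M N
      have hq := hquad hN'N
      obtain ⟨hα1, hα2, -⟩ := hall ⟨M, hM, hMN⟩
      set α := a' ⟨M, hM, hMN⟩ with hα
      have hlamM : lam ⟨M, hM, hMN⟩ = χ M * (M : ℂ) ^ (k - 1) := if_pos rfl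
      rw [hlamM] at hα2
      set y := ι.symm (χ M * (M : ℂ) ^ (k - 1)) with hy
      -- `y` is a unit
      have hyn : ‖y‖ = 1 := by
        have hMu : IsUnit (M : ZMod N) := (ZMod.isUnit_prime_iff_not_dvd hM).2 hMN
        have hχM : ‖ι.symm (χ M)‖ = 1 := by
          have hm0 : m ≠ 0 := fun h0 ↦ hm (h0 ▸ dvd_zero p)
          have h1 : (ι.symm (χ M)) ^ m = 1 := by
            rw [← map_pow, ← IsUnit.unit_spec hMu, ← MulChar.pow_apply_coe, hχm,
              MulChar.one_apply_coe, map_one]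
          have h2 : ‖ι.symm (χ M)‖ ^ m = 1 := by rw [← norm_pow, h1, norm_one]
          exact (pow_eq_one_iff_of_nonneg (norm_nonneg _) hm0).1 h2
        rw [hy, map_mul, map_pow, norm_mul, norm_pow, hχM, hMv, one_pow, one_mul]
      have hαn : ‖α‖ = 1 := by
        refine le_antisymm hα1 (not_lt.mp fun hlt ↦ ?_)
        have h1 : ‖y‖ < 1 := by
          have h2 : y = α - (α - y) := by ring
          rw [h2]
          exact (hsub _ _).trans_lt (max_lt hlt hα2)
        rw [hyn] at h1
        exact lt_irrefl _ h1
      -- the quadratic relation read in `ℚ̄_p`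
      rw [hzpow] at hq
      have hq' : α ^ 2 - ι.symm (cuspCoeff g₀ M) * α + y = 0 := by
        have h1 := congrArg ι.symm hq
        rwa [map_zero, map_add, map_sub, map_pow, map_mul, RingEquiv.symm_apply_apply] at h1
      rw [hℓM, hzpow, hvlt, map_add, map_one]
      have hkey : (ι.symm (cuspCoeff g₀ M) - (1 + y)) * α = (α - y) * (α - 1) := by
        linear_combination -hq'
      have h3 : ‖(ι.symm (cuspCoeff g₀ M) - (1 + y)) * α‖ < 1 := by
        rw [hkey, norm_mul]
        calc ‖α - y‖ * ‖α - 1‖ ≤ ‖α - y‖ * 1 := by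
              gcongr
              exact (hsub _ _).trans (max_le hα1 (by rw [norm_one]))
          _ < 1 := by rw [mul_one]; exact hα2
      rwa [norm_mul, hαn, mul_one] at h3
    · -- `ℓ ∤ NM`: `a_ℓ(g₀) = a_ℓ(g) = ι(a'_ℓ)`
      have hℓNM : ¬ ℓ ∣ N * M := fun h ↦ by
        rcases (Nat.Prime.dvd_mul hℓ).1 h with h1 | h1
        · exact hℓN h1
        · exact hℓM ((Nat.prime_dvd_prime_iff_eq hℓ hM).mp h1)
      rw [hcoef ℓ hℓ hℓNM]
      simp only [aC, dif_pos (And.intro hℓ hℓN), RingEquiv.symm_apply_apply]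
      obtain ⟨-, h2, -⟩ := hall ⟨ℓ, hℓ, hℓN⟩
      have hlamℓ : lam ⟨ℓ, hℓ, hℓN⟩ = 1 + χ ℓ * (ℓ : ℂ) ^ (k - 1) := if_neg hℓM
      rw [hlamℓ] at h2
      rw [hzpow, hvlt]
      exact h2

end Main

end Literature.NumberTheory.EllipticCurves.ModularForms
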